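import Mathlib
import HarnessLib

/-!
# Area of a "tent window" (BLUEPRINT L5 for stub `stub_sliceDomination` of line `LayerChain`,
# crux `StackingLiminf`, stmt-Ventures-19145)

Route `StickyWulffConstant` of the venture `Summits/Ventures/Crystal3D` (cell `crystal3d-full`).
Every horizontal section of the homogenised stacking Wulff bodies `W_f` (cf-p2 R19,
`BLUEPRINT-sliceDomination.md` §2) is a TENT WINDOW
`{p : ℝ × ℝ | a ≤ p.2 ≤ b, |p.1| ≤ P − κ |p.2 − c|}` with `a ≤ c ≤ b` and `κ (c − a), κ (b − c) ≤ P`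
(a hexagon, mirror-symmetric in `p.1`).  This file computes its Lebesgue measure EXACTLY:
`2 P (b − a) − κ ((c − a)² + (b − c)²)` (Fubini over the second coordinate: the fibre at height
`t` is the interval `[−X(t), X(t)]`, `X(t) = P − κ|t − c| ≥ 0`, then a piecewise-affine interval
integral split at `c`).  Used for BOTH directions of slice domination (outer bound of the `f = 0`
sections, inner bound of the `W_f` sections).
WHAT THIS IS NOT: slice domination itself; nothing about the crux; rung F-C1 not moved.
-/

noncomputable section

namespace Summit.Ventures.Crystal3D.Theorems

open MeasureTheory Set

/-- The piecewise-affine profile integral: `∫_a^b 2 (P − κ |t − c|) dt` for `a ≤ c ≤ b`. -/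
theorem integral_tent_profile (a b c P κ : ℝ) (hac : a ≤ c) (hcb : c ≤ b) :
    ∫ t in a..b, (2 * (P - κ * |t - c|)) = 2 * P * (b - a) - κ * ((c - a) ^ 2 + (b - c) ^ 2) := by
  have hcont : Continuous fun t : ℝ => 2 * (P - κ * |t - c|) := by fun_prop
  have hint : ∀ u v : ℝ, IntervalIntegrable (fun t : ℝ => 2 * (P - κ * |t - c|)) volume u v :=
    fun u v => hcont.intervalIntegrable u v
  rw [← intervalIntegral.integral_add_adjacent_intervals (hint a c) (hint c b)]
  -- on `[a, c]` the integrand is `2 (P − κ (c − t))`, on `[c, b]` it is `2 (P − κ (t − c))`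
  have h1 : ∫ t in a..c, (2 * (P - κ * |t - c|)) = ∫ t in a..c, (2 * (P - κ * (c - t))) := by
    refine intervalIntegral.integral_congr fun t ht => ?_
    rw [uIcc_of_le hac] at ht
    simp only [abs_of_nonpos (sub_nonpos.2 ht.2), neg_sub]
  have h2 : ∫ t in c..b, (2 * (P - κ * |t - c|)) = ∫ t in c..b, (2 * (P - κ * (t - c))) := by
    refine intervalIntegral.integral_congr fun t ht => ?_
    rw [uIcc_of_le hcb] at ht
    simp only [abs_of_nonneg (sub_nonneg.2 ht.1)]
  rw [h1, h2]
  have e1 : ∫ t in a..c, (2 * (P - κ * (c - t))) =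
      (2 * P - 2 * κ * c) * (c - a) + κ * (c ^ 2 - a ^ 2) := by
    have : (fun t : ℝ => 2 * (P - κ * (c - t))) = fun t => (2 * P - 2 * κ * c) + (2 * κ) * t := by
      funext t; ring
    have i1 : IntervalIntegrable (fun _ : ℝ => (2 * P - 2 * κ * c)) volume a c :=
      intervalIntegrable_const
    have i2 : IntervalIntegrable (fun t : ℝ => (2 * κ) * t) volume a c :=
      Continuous.intervalIntegrable (by fun_prop) _ _
    rw [this, intervalIntegral.integral_add i1 i2, intervalIntegral.integral_const,
      intervalIntegral.integral_const_mul, integral_id, smul_eq_mul]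
    ring
  have e2 : ∫ t in c..b, (2 * (P - κ * (t - c))) =
      (2 * P + 2 * κ * c) * (b - c) - κ * (b ^ 2 - c ^ 2) := by
    have : (fun t : ℝ => 2 * (P - κ * (t - c))) = fun t => (2 * P + 2 * κ * c) + (-(2 * κ)) * t := by
      funext t; ring
    have i1 : IntervalIntegrable (fun _ : ℝ => (2 * P + 2 * κ * c)) volume c b :=
      intervalIntegrable_const
    have i2 : IntervalIntegrable (fun t : ℝ => (-(2 * κ)) * t) volume c b :=
      Continuous.intervalIntegrable (by fun_prop) _ _
    rw [this, intervalIntegral.integral_add i1 i2, intervalIntegral.integral_const,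
      intervalIntegral.integral_const_mul, integral_id, smul_eq_mul]
    ring
  rw [e1, e2]
  ring

/-- The tent window is measurable. -/
theorem measurableSet_tentWindow (a b c P κ : ℝ) :
    MeasurableSet {p : ℝ × ℝ | a ≤ p.2 ∧ p.2 ≤ b ∧ |p.1| ≤ P - κ * |p.2 - c|} := by
  have h1 : MeasurableSet {p : ℝ × ℝ | a ≤ p.2} := measurableSet_le measurable_const measurable_snd
  have h2 : MeasurableSet {p : ℝ × ℝ | p.2 ≤ b} := measurableSet_le measurable_snd measurable_const
  have h3 : MeasurableSet {p : ℝ × ℝ | |p.1| ≤ P - κ * |p.2 - c|} :=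
    measurableSet_le (by fun_prop) (by fun_prop)
  simpa only [setOf_and] using h1.inter (h2.inter h3)

/-- **Area of a tent window (BLUEPRINT L5).**  For `a ≤ c ≤ b`, `0 ≤ κ` and
`κ (c − a) ≤ P`, `κ (b − c) ≤ P`, the hexagon `{p | a ≤ p.2 ≤ b, |p.1| ≤ P − κ |p.2 − c|}` has
Lebesgue measure `2 P (b − a) − κ ((c − a)² + (b − c)²)`. -/
theorem volume_tentWindow (a b c P κ : ℝ) (hac : a ≤ c) (hcb : c ≤ b) (hκ : 0 ≤ κ)
    (hPa : κ * (c - a) ≤ P) (hPb : κ * (b - c) ≤ P) :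
    volume {p : ℝ × ℝ | a ≤ p.2 ∧ p.2 ≤ b ∧ |p.1| ≤ P - κ * |p.2 - c|} =
      ENNReal.ofReal (2 * P * (b - a) - κ * ((c - a) ^ 2 + (b - c) ^ 2)) := by
  set S := {p : ℝ × ℝ | a ≤ p.2 ∧ p.2 ≤ b ∧ |p.1| ≤ P - κ * |p.2 - c|} with hS
  have hSm : MeasurableSet S := measurableSet_tentWindow a b c P κ
  -- the profile is nonnegative on `[a, b]`
  have hX : ∀ t, a ≤ t → t ≤ b → 0 ≤ P - κ * |t - c| := by
    intro t hat htb
    have : κ * |t - c| ≤ P := by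
      rcases le_total t c with h | h
      · rw [abs_of_nonpos (sub_nonpos.2 h), neg_sub]
        exact (mul_le_mul_of_nonneg_left (by linarith) hκ).trans hPa
      · rw [abs_of_nonneg (sub_nonneg.2 h)]
        exact (mul_le_mul_of_nonneg_left (by linarith) hκ).trans hPb
    linarith
  -- Fubini over the second coordinate
  rw [Measure.volume_eq_prod, Measure.prod_apply_symm hSm]
  have hfib : ∀ t : ℝ, volume ((fun x : ℝ => (x, t)) ⁻¹' S) =
      (Icc a b).indicator (fun t => ENNReal.ofReal (2 * (P - κ * |t - c|))) t := by
    intro t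
    by_cases ht : t ∈ Icc a b
    · rw [indicator_of_mem ht]
      have : (fun x : ℝ => (x, t)) ⁻¹' S = Icc (-(P - κ * |t - c|)) (P - κ * |t - c|) := by
        ext x
        simp only [hS, mem_preimage, mem_setOf_eq, mem_Icc, abs_le]
        exact ⟨fun h => h.2.2, fun h => ⟨ht.1, ht.2, h⟩⟩
      rw [this, Real.volume_Icc]
      congr 1; ring
    · rw [indicator_of_notMem ht]
      have : (fun x : ℝ => (x, t)) ⁻¹' S = ∅ := by
        ext x
        simp only [hS, mem_preimage, mem_setOf_eq, mem_empty_iff_false, iff_false, not_and]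
        intro h1 h2
        exact absurd (⟨h1, h2⟩ : t ∈ Icc a b) ht
      rw [this, measure_empty]
  simp_rw [hfib]
  rw [lintegral_indicator measurableSet_Icc]
  have hab : a ≤ b := hac.trans hcb
  have hintg : IntegrableOn (fun t : ℝ => 2 * (P - κ * |t - c|)) (Icc a b) volume :=
    (Continuous.continuousOn (by fun_prop)).integrableOn_Icc
  rw [← ofReal_integral_eq_lintegral_ofReal hintg]
  · rw [integral_Icc_eq_integral_Ioc, ← intervalIntegral.integral_of_le hab,
      integral_tent_profile a b c P κ hac hcb]
  · refine (ae_restrict_iff' measurableSet_Icc).2 (Filter.Eventually.of_forall fun t ht => ?_)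
    have := hX t ht.1 ht.2
    positivity

end Summit.Ventures.Crystal3D.Theorems

end
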